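import Summits.SmoothPoincare4.SmoothPoincare4.Theses.WrinkleUnlinking

/-!
# Crux `WrinkleUnlinking.DepthTwoRung` (stmt-SmoothPoincare4-10372) — birth skeleton (`Lines/birth.lean`)

Registered skeleton (planner, mode `skeleton-register`, route re-audit bin REPAIRABLE) for the
rank-3 crux `Summit.SmoothPoincare4.SmoothPoincare4.Theses.WrinkleUnlinking.DepthTwoRung` of
route-SmoothPoincare4-WrinkleUnlinking: three named stubs `stub_isolatedCancel`, `stub_leafCut`,
`stub_coreCut` (statements `IsolatedCancel`, `LeafCut`, `CoreCut`, named below) and the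
kernel-checked composition
`DepthTwoRung_of : Registered.stub_isolatedCancel → Registered.stub_leafCut → Registered.stub_coreCut → DepthTwoRung`
(conclusion = the crux BY NAME; hypotheses = the stub statements under the registered stub names,
the `Registered` alias device of `ValiantsHypothesis/Cruxes/RestorationQP/Lines/birth.lean`; the
only sorries of the file are the three stub bodies).  A prover closing a stub re-declares the
`def`s of this file verbatim in this namespace and proves `theorem stub_<name> : <Statement>`
(pattern of `Theorems/CongruenceShadowsAgkCor6SufficiencyStubFillingUniqueness.lean`).

## The crux

`DepthTwoRung`: a homotopy 4-sphere `M` carrying a DEGREE-ONE WRINKLED MAP `p : M → S⁴` with `k`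
wrinkle discs `D i` (the ~1300-character inlined predicate of the route file, abbreviated here as
`IsW M p k D` — a verbatim copy, so that `DepthTwoRung` unfolds DEFINITIONALLY to
`∀ M …, IsW M p k D → DepthLeTwo p k D → Nonempty (M ≃ₘ S⁴)`, checked by `Iff.rfl` below) whose
LENS IMAGES `L i = p '' D i` have DEPTH ≤ 2 (`DepthLeTwo`: no point of `S⁴` lies in three lens
images with pairwise distinct indices) is diffeomorphic to `S⁴`.

## The line: induction on the wrinkle number along the OVERLAP GRAPH

Let `Γ` be the overlap graph on the wrinkles (`i ∼ j` iff `L i ∩ L j ≠ ∅`).  Depth ≤ 2 forbids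
triple points, but neither cycles ("necklaces") nor vertices of high degree.  Classify a wrinkle
`i` by its degree in `Γ`: ISOLATED (degree 0, `Isolated`), a LEAF hanging on `j` (degree exactly 1,
`Leaf i j`), or of degree ≥ 2; `LooseEnd i` says degree ≤ 1, `Core` says every wrinkle has degree
≥ 2.  The route header's engine ("a clean wrinkle … cancels; a minimal presentation of an exotic Σ
has every wrinkle invaded by another (clasp cycles)"; TWO-LAYER PLAN
`DepthTwoRung ⇐ TwoWrinkleRung → NecklaceRung → DepthTwoRung`) becomes three
wrinkle-number–reducing moves, one per degree class, and `DepthTwoRung_of` is the strong induction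
on `k` they drive (base `k = 0`, PROVED here: a degree-one wrinkled map without wrinkles is a
bijective `C^∞` local diffeomorphism, hence a diffeomorphism —
`IsLocalDiffeomorph.diffeomorphOfBijective`):

* `IsolatedCancel` / `stub_isolatedCancel` (PARKING LEMMA; size L–XL, believed provable with the
  UnlinkingLemma technology): an isolated wrinkle can be cancelled keeping depth ≤ 2 — over a chart
  ball `N ⊃ L i` missing the other lenses the packet `p ⁻¹ N` is one-sheeted near `∂N` and is a
  smooth 4-ball (the full three-sheeted model packet, exactly the content of support item
  `UnlinkingLemma`, stmt-SmoothPoincare4-10374); replace `p` on it by a diffeomorphism onto `N`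
  extending `p` near `∂N` (for the model packet this extension is EXPLICIT: the embryo
  deformation `w_ρ(y,z) = (y, z³ + 3(|y|² - ρ²)z)`, `ρ ↓ 0`, plus isotopy extension — no appeal to
  Cerf `Γ₄ = 0` is needed, though `cerf_twistedSphere_four` / `palais_ballComplement_sphere_four`
  would also do), spliced smoothly along the one-sheeted collar; the other
  `k - 1` wrinkles, their (shrunk) charts and their lens images are untouched, so depth stays ≤ 2
  and degree one is kept.  Why it might fail: only through a leak of the inlined predicate (the two
  outer sheets of the model need not lie in the source chart `U i`, so the packet must be
  recognised from the covering structure over `int L i`, not read off the chart).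
* `LeafCut` / `stub_leafCut` (LOOSE CLASP; size XL — the local two-lens content of the rank-2 crux
  `TwoWrinkleRung`, made relative): a leaf wrinkle `i` (meeting exactly one other lens `L j`) can be
  removed so that the wrinkle number drops and depth stays ≤ 2 — localise in a chart ball
  `N ⊃ L i` with `N ∩ L l = ∅ (l ≠ i, j)`; inside, only the three sheets of `i` and the fold sheets
  of `j` interact (5 sheets over `L i ∩ L j`); cancel `i` against its clasp with `j` (cusp–fold
  surgery of Eliashberg–Mishachev wrinkles) or recognise the relative packet as a ball.  Why it
  might fail: overlap cells of two chart balls in `S⁴` can be Schoenflies-type fake cells or encode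
  a Gluck twist (the route's stated risk for `TwoWrinkleRung`), and the statement is RELATIVE
  (`j` continues outside `N`).
* `CoreCut` / `stub_coreCut` (NECKLACE RUNG; open-problem sized, the genuinely global piece and the
  HARDEST stub): if every wrinkle meets at least two others (so `k ≥ 3` and `Γ` has cycles —
  necklaces of pairwise clasped lenses around loops of `S⁴`), the presentation can be traded for
  one of depth ≤ 2 on the same `M` with FEWER wrinkles, OR with at most as many wrinkles and a
  LOOSE END — "cut the necklace open".  Why it might fail: necklaces around loops may realise spun /
  twist-spun (Gluck) presentations, and pairwise analysis need not globalise (the route's stated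
  risk for this crux).

Each stub is implied by the crux (under its hypotheses `DepthTwoRung` yields `M ≃ₘ S⁴`, and a
diffeomorphism is a depth-0 presentation with `k' = 0`), so no stub is falser than the crux; none
gives the crux or `SmoothPoincare4` cheaply (BC3 probes `stub → DepthTwoRung` and
`stub → SmoothPoincare4` by `first | exact? | simpa | aesop` all FAIL, recorded in the planner's
NOTES); their conjunction gives the crux by the induction below.  COROLLARY (`twoWrinkleRung_of`,
coherence with the route, not part of the registration): the two LOCAL moves alone already give
the rank-2 crux `TwoWrinkleRung` (with `k ≤ 2` every wrinkle is a loose end), which makes precise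
the header's claim that `DepthTwoRung` exceeds `TwoWrinkleRung` exactly by the necklace rung.

Disproof used: none relevant — `ledger crux ls stmt-SmoothPoincare4-10372` shows no `Disproof.lean`
and no `Negative/` lemma at registration (2026-08-17); the refuter's crux-attack (2026-08-15,
SURVIVES) recorded `SmoothPoincare4 → DepthTwoRung`, the `k = 0` slice true outright, hypotheses
satisfiable (`M = S⁴, p = id, k = 0`) — consistent with the base case proved here.
-/

open scoped Manifold ContDiff ContinuousMap Topology
open Set

-- the prescribed namespace `Summit.<P>.<Sub>.…` duplicates `SmoothPoincare4` (P = Sub)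
set_option linter.dupNamespace false

namespace Summit.SmoothPoincare4.SmoothPoincare4.Cruxes.DepthTwoRung.Birth

open Summit.SmoothPoincare4.SmoothPoincare4.Theses.WrinkleUnlinking (TwoWrinkleRung DepthTwoRung)

/-! ## Vocabulary (verbatim pieces of the crux, plus the degree classes of the overlap graph) -/

/-- `IsW M p k D`: `p : M → S⁴` is a degree-one wrinkled map with wrinkle discs `D i` — the
VERBATIM inlined predicate of every item of route WrinkleUnlinking (smooth; discs pairwise disjoint;
local diffeomorphism off the discs; exactly one preimage over every point outside the lens images,
and such a point exists; source/target charts conjugating `p` near each disc to the standard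
Eliashberg–Mishachev wrinkle `w(y,z) = (y, z³ + 3(|y|²-1)z)`, with `φ '' D i` the closed unit ball). -/
def IsW (M : Type) [TopologicalSpace M] [ChartedSpace (EuclideanSpace ℝ (Fin 4)) M]
    (p : M → Metric.sphere (0 : EuclideanSpace ℝ (Fin 5)) 1) (k : ℕ) (D : Fin k → Set M) : Prop :=
  ContMDiff (𝓡 4) (𝓡 4) ∞ p ∧ Pairwise (Function.onFun Disjoint D) ∧ (∀ x, x ∉ (⋃ i, D i) → IsLocalDiffeomorphAt (𝓡 4) (𝓡 4) ∞ p x) ∧ (∀ y, y ∉ (⋃ i, p '' (D i)) → ∃! x, p x = y) ∧ (∃ y, y ∉ ⋃ i, p '' (D i)) ∧ ∀ i, ∃ (U : Set M) (φ : M → EuclideanSpace ℝ (Fin 4)) (V : Set (Metric.sphere (0 : EuclideanSpace ℝ (Fin 5)) 1)) (ψ : (Metric.sphere (0 : EuclideanSpace ℝ (Fin 5)) 1) → EuclideanSpace ℝ (Fin 4)), IsOpen U ∧ D i ⊆ U ∧ Set.InjOn φ U ∧ (∀ x ∈ U, IsLocalDiffeomorphAt (𝓡 4) (𝓡 4) ∞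 φ x) ∧ φ '' (D i) = Metric.closedBall (0 : EuclideanSpace ℝ (Fin 4)) 1 ∧ IsOpen V ∧ p '' U ⊆ V ∧ Set.InjOn ψ V ∧ (∀ y ∈ V, IsLocalDiffeomorphAt (𝓡 4) (𝓡 4) ∞ ψ y) ∧ ∀ x ∈ U, ψ (p x) = WithLp.toLp 2 (fun j : Fin 4 => if j = 3 then (φ x 3) ^ 3 + 3 * ((φ x 0) ^ 2 + (φ x 1) ^ 2 + (φ x 2) ^ 2 - 1) * φ x 3 else φ x j)

/-- `DepthLeTwo p k D`: lens depth ≤ 2 — no point of `S⁴` lies in three lens images `p '' D i`,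
`p '' D j`, `p '' D l` with pairwise distinct indices (verbatim second hypothesis of the crux). -/
def DepthLeTwo {M : Type} (p : M → Metric.sphere (0 : EuclideanSpace ℝ (Fin 5)) 1) (k : ℕ)
    (D : Fin k → Set M) : Prop :=
  ∀ (y : Metric.sphere (0 : EuclideanSpace ℝ (Fin 5)) 1) (i j l : Fin k), i ≠ j → j ≠ l → i ≠ l → ¬ (y ∈ p '' (D i) ∧ y ∈ p '' (D j) ∧ y ∈ p '' (D l))

/-- Wrinkle `i` is ISOLATED (degree 0 in the overlap graph): its lens image misses every other
lens image. -/
def Isolated {M : Type} (p : M → Metric.sphere (0 : EuclideanSpace ℝ (Fin 5)) 1) (k : ℕ)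
    (D : Fin k → Set M) (i : Fin k) : Prop :=
  ∀ j : Fin k, j ≠ i → Disjoint (p '' (D i)) (p '' (D j))

/-- Wrinkle `i` is a LEAF hanging on `j` (degree exactly 1): `L i` meets `L j` and no other lens. -/
def Leaf {M : Type} (p : M → Metric.sphere (0 : EuclideanSpace ℝ (Fin 5)) 1) (k : ℕ)
    (D : Fin k → Set M) (i j : Fin k) : Prop :=
  j ≠ i ∧ (p '' (D i) ∩ p '' (D j)).Nonempty ∧
    ∀ l : Fin k, l ≠ i → l ≠ j → Disjoint (p '' (D i)) (p '' (D l))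

/-- Wrinkle `i` is a LOOSE END (degree ≤ 1): of any two distinct other wrinkles at least one has
lens image disjoint from `L i`. -/
def LooseEnd {M : Type} (p : M → Metric.sphere (0 : EuclideanSpace ℝ (Fin 5)) 1) (k : ℕ)
    (D : Fin k → Set M) (i : Fin k) : Prop :=
  ∀ j l : Fin k, j ≠ i → l ≠ i → j ≠ l →
    Disjoint (p '' (D i)) (p '' (D j)) ∨ Disjoint (p '' (D i)) (p '' (D l))

/-- The presentation is a CORE (minimum degree ≥ 2 — "all necklaces"): every lens image meets at
least two other lens images. -/
def Core {M : Type} (p : M → Metric.sphere (0 : EuclideanSpace ℝ (Fin 5)) 1) (k : ℕ)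
    (D : Fin k → Set M) : Prop :=
  ∀ i : Fin k, ∃ j l : Fin k, j ≠ i ∧ l ≠ i ∧ j ≠ l ∧
    (p '' (D i) ∩ p '' (D j)).Nonempty ∧ (p '' (D i) ∩ p '' (D l)).Nonempty

/-- Read-back check: the crux is, DEFINITIONALLY, "`IsW` and `DepthLeTwo` give `M ≃ₘ S⁴`". -/
example :
    DepthTwoRung ↔
      ∀ (M : Type) [TopologicalSpace M] [T2Space M] [SecondCountableTopology M]
        [ChartedSpace (EuclideanSpace ℝ (Fin 4)) M] [IsManifold (𝓡 4) ∞ M],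
        (M ≃ₕ Metric.sphere (0 : EuclideanSpace ℝ (Fin 5)) 1) →
          ∀ (p : M → Metric.sphere (0 : EuclideanSpace ℝ (Fin 5)) 1) (k : ℕ) (D : Fin k → Set M),
            IsW M p k D → DepthLeTwo p k D →
              Nonempty (M ≃ₘ⟮𝓡 4, 𝓡 4⟯ Metric.sphere (0 : EuclideanSpace ℝ (Fin 5)) 1) :=
  Iff.rfl

/-! ## The three stub statements (named) -/

/-- **`IsolatedCancel` — PARKING LEMMA** (statement of `stub_isolatedCancel`; size L–XL).  In a
degree-one wrinkled map of depth ≤ 2 on a homotopy 4-sphere, an ISOLATED wrinkle (lens image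
disjoint from all other lens images) can be cancelled: there is a degree-one wrinkled map on the
same `M` with fewer wrinkles and depth still ≤ 2.  Mechanism: chart ball `N ⊃ L i` missing the
other lenses; the packet `p ⁻¹ N` is a smooth 4-ball, one-sheeted over a collar of `∂N`; replace
`p` on it by a diffeomorphism onto `N` extending `p` near the boundary (explicit for the model
packet via the embryo deformation `w_ρ`, `ρ ↓ 0`, and isotopy extension; alternatively Cerf
`Γ₄ = 0`); the remaining wrinkles, their (shrunk) charts and lens images are unchanged, so the
new presentation may even be taken with `k' = k - 1` and the same other lenses (the weak
conclusion `k' < k` is all the induction needs and keeps the stub implied by the crux).  [EliashbergMishachev1997 §1; Cerf1968; Palais1960; route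
support item UnlinkingLemma = stmt-SmoothPoincare4-10374] -/
def IsolatedCancel : Prop :=
  ∀ (M : Type) [TopologicalSpace M] [T2Space M] [SecondCountableTopology M]
    [ChartedSpace (EuclideanSpace ℝ (Fin 4)) M] [IsManifold (𝓡 4) ∞ M],
    (M ≃ₕ Metric.sphere (0 : EuclideanSpace ℝ (Fin 5)) 1) →
      ∀ (p : M → Metric.sphere (0 : EuclideanSpace ℝ (Fin 5)) 1) (k : ℕ) (D : Fin k → Set M),
        IsW M p k D → DepthLeTwo p k D →
          ∀ i : Fin k, Isolated p k D i →
            ∃ (p' : M → Metric.sphere (0 : EuclideanSpace ℝ (Fin 5)) 1) (k' : ℕ) (D' : Fin k' → Set M),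
              k' < k ∧ IsW M p' k' D' ∧ DepthLeTwo p' k' D'

/-- **`LeafCut` — LOOSE CLASP** (statement of `stub_leafCut`; size XL).  In a degree-one wrinkled
map of depth ≤ 2 on a homotopy 4-sphere, a LEAF wrinkle `i` (its lens meets exactly one other lens
`L j`) can be removed: there is a degree-one wrinkled map on the same `M` with fewer wrinkles and
depth ≤ 2.  Mechanism: localise in a chart ball `N ⊃ L i` disjoint from the lenses `L l (l ≠ i, j)`;
inside `N` only the three sheets of `i` and the fold sheets of `j` interact (five sheets over
`L i ∩ L j`); cancel `i` against its clasp with `j` by cusp–fold surgery, or recognise the relative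
packet as in the two-lens analysis of `TwoWrinkleRung`.  Why it might fail: overlap cells of two
chart balls can be Schoenflies-type fake cells or encode a Gluck twist.  [EliashbergMishachev1997;
Cerf1968; Palais1960; SaekiSakuma1999] -/
def LeafCut : Prop :=
  ∀ (M : Type) [TopologicalSpace M] [T2Space M] [SecondCountableTopology M]
    [ChartedSpace (EuclideanSpace ℝ (Fin 4)) M] [IsManifold (𝓡 4) ∞ M],
    (M ≃ₕ Metric.sphere (0 : EuclideanSpace ℝ (Fin 5)) 1) →
      ∀ (p : M → Metric.sphere (0 : EuclideanSpace ℝ (Fin 5)) 1) (k : ℕ) (D : Fin k → Set M),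
        IsW M p k D → DepthLeTwo p k D →
          ∀ i j : Fin k, Leaf p k D i j →
            ∃ (p' : M → Metric.sphere (0 : EuclideanSpace ℝ (Fin 5)) 1) (k' : ℕ) (D' : Fin k' → Set M),
              k' < k ∧ IsW M p' k' D' ∧ DepthLeTwo p' k' D'

/-- **`CoreCut` — NECKLACE RUNG** (statement of `stub_coreCut`; open-problem sized, the hardest
stub).  If every wrinkle of a depth ≤ 2 degree-one wrinkled map on a homotopy 4-sphere meets at
least two other lenses (`Core`: minimum degree ≥ 2 in the overlap graph — necklaces of pairwise
clasped lenses around loops of `S⁴`; the explicit `3 ≤ k` only excludes the vacuous `k = 0`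
reading of `Core` and is implied by it otherwise, `three_le_of_core`), then there is a depth ≤ 2 degree-one
wrinkled map on the same `M` with fewer wrinkles, or with at most as many wrinkles and a LOOSE END
(a wrinkle meeting at most one other lens): the necklace can be cut open.  Why it might fail:
necklaces may realise spun / twist-spun (Gluck) presentations; pairwise analysis need not
globalise.  [EliashbergMishachev1997; SaekiSakuma1999; Cerf1968] -/
def CoreCut : Prop :=
  ∀ (M : Type) [TopologicalSpace M] [T2Space M] [SecondCountableTopology M]
    [ChartedSpace (EuclideanSpace ℝ (Fin 4)) M] [IsManifold (𝓡 4) ∞ M],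
    (M ≃ₕ Metric.sphere (0 : EuclideanSpace ℝ (Fin 5)) 1) →
      ∀ (p : M → Metric.sphere (0 : EuclideanSpace ℝ (Fin 5)) 1) (k : ℕ) (D : Fin k → Set M),
        IsW M p k D → DepthLeTwo p k D →
          3 ≤ k → Core p k D →
            ∃ (p' : M → Metric.sphere (0 : EuclideanSpace ℝ (Fin 5)) 1) (k' : ℕ) (D' : Fin k' → Set M),
              IsW M p' k' D' ∧ DepthLeTwo p' k' D' ∧
                (k' < k ∨ (k' ≤ k ∧ ∃ i : Fin k', LooseEnd p' k' D' i))

/-! ## Stubs (the ONLY sorries of this file) -/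

/-- Stub 1 — parking lemma (registered obligation; statement `IsolatedCancel`). -/
theorem stub_isolatedCancel : IsolatedCancel := by
  sorry

/-- Stub 2 — loose clasp (registered obligation; statement `LeafCut`). -/
theorem stub_leafCut : LeafCut := by
  sorry

/-- Stub 3 — necklace rung (registered obligation; statement `CoreCut`; the hardest stub). -/
theorem stub_coreCut : CoreCut := by
  sorry

/-! ## Name-keyed aliases of the stub statements (hypotheses of the composition)

`Registered.stub_X` is the statement of `stub_X` under the registered stub's short name, so that the
native skeleton audit (`#h21_check_skeleton`: hypotheses admissible iff registered obligations /
declared stubs BY NAME) accepts `DepthTwoRung_of` below (device of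
`ValiantsHypothesis/Cruxes/RestorationQP/Lines/birth.lean`). -/
namespace Registered

/-- Alias of `IsolatedCancel` (= the statement of `stub_isolatedCancel`). -/
abbrev stub_isolatedCancel : Prop := IsolatedCancel
/-- Alias of `LeafCut` (= the statement of `stub_leafCut`). -/
abbrev stub_leafCut : Prop := LeafCut
/-- Alias of `CoreCut` (= the statement of `stub_coreCut`). -/
abbrev stub_coreCut : Prop := CoreCut

end Registered

/-! ## Composition (real proofs — no `sorry` below this line) -/

section glue

variable {M : Type} {p : M → Metric.sphere (0 : EuclideanSpace ℝ (Fin 5)) 1} {k : ℕ}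
  {D : Fin k → Set M}

/-- A loose end is isolated or a leaf. -/
theorem isolated_or_leaf_of_looseEnd {i : Fin k} (h : LooseEnd p k D i) :
    Isolated p k D i ∨ ∃ j, Leaf p k D i j := by
  by_cases hj : ∃ j : Fin k, j ≠ i ∧ (p '' (D i) ∩ p '' (D j)).Nonempty
  · obtain ⟨j, hji, hij⟩ := hj
    refine Or.inr ⟨j, hji, hij, fun l hli hlj => ?_⟩
    rcases h j l hji hli (Ne.symm hlj) with hd | hd
    · exact absurd hij (Set.disjoint_iff_inter_eq_empty.mp hd ▸ Set.not_nonempty_empty)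
    · exact hd
  · exact Or.inl fun j hji => Set.disjoint_iff_inter_eq_empty.mpr
      (Set.not_nonempty_iff_eq_empty.mp fun hne => hj ⟨j, hji, hne⟩)

/-- No loose end means the presentation is a core. -/
theorem core_of_no_looseEnd (h : ¬ ∃ i : Fin k, LooseEnd p k D i) : Core p k D := by
  intro i
  by_contra hc
  refine h ⟨i, fun j l hji hli hjl => ?_⟩
  by_contra hor
  refine hc ⟨j, l, hji, hli, hjl, ?_, ?_⟩
  · exact Set.not_disjoint_iff_nonempty_inter.mp fun hd => hor (Or.inl hd)
  · exact Set.not_disjoint_iff_nonempty_inter.mp fun hd => hor (Or.inr hd)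

/-- A core with at least one wrinkle has at least three (its first wrinkle meets two distinct
others); `Core p 0 D` alone is vacuously true, whence the explicit `3 ≤ k` in `CoreCut`. -/
theorem three_le_of_core (hk : 0 < k) (h : Core p k D) : 3 ≤ k := by
  obtain ⟨j, l, hji, hli, hjl, -, -⟩ := h ⟨0, hk⟩
  have h2 := j.isLt; have h3 := l.isLt
  simp only [ne_eq, Fin.ext_iff] at hji hli hjl
  omega

end glue

/-- Base of the induction (`k = 0`, proved outright): a degree-one wrinkled map without wrinkles
is a bijective `C^∞` local diffeomorphism, hence a diffeomorphism. -/
theorem nonempty_diffeomorph_of_isW_zero (M : Type) [TopologicalSpace M] [T2Space M]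
    [SecondCountableTopology M] [ChartedSpace (EuclideanSpace ℝ (Fin 4)) M] [IsManifold (𝓡 4) ∞ M]
    (p : M → Metric.sphere (0 : EuclideanSpace ℝ (Fin 5)) 1) (D : Fin 0 → Set M)
    (hW : IsW M p 0 D) :
    Nonempty (M ≃ₘ⟮𝓡 4, 𝓡 4⟯ Metric.sphere (0 : EuclideanSpace ℝ (Fin 5)) 1) := by
  obtain ⟨-, -, hloc, huniq, -, -⟩ := hW
  have hld : IsLocalDiffeomorph (𝓡 4) (𝓡 4) ∞ p := fun x => hloc x (by simp)
  have hbij : Function.Bijective p := by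
    refine ⟨fun a b hab => ?_, fun y => ?_⟩
    · obtain ⟨x, -, hx⟩ := huniq (p b) (by simp)
      exact (hx a hab).trans (hx b rfl).symm
    · obtain ⟨x, hx, -⟩ := huniq y (by simp)
      exact ⟨x, hx⟩
  exact ⟨hld.diffeomorphOfBijective hbij⟩

/-- The two LOCAL moves reduce the wrinkle number at any loose end. -/
theorem looseEnd_reduce (hIso : IsolatedCancel) (hLeaf : LeafCut)
    (M : Type) [TopologicalSpace M] [T2Space M] [SecondCountableTopology M]
    [ChartedSpace (EuclideanSpace ℝ (Fin 4)) M] [IsManifold (𝓡 4) ∞ M]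
    (e : M ≃ₕ Metric.sphere (0 : EuclideanSpace ℝ (Fin 5)) 1)
    (p : M → Metric.sphere (0 : EuclideanSpace ℝ (Fin 5)) 1) (k : ℕ) (D : Fin k → Set M)
    (hW : IsW M p k D) (hd : DepthLeTwo p k D) (hle : ∃ i : Fin k, LooseEnd p k D i) :
    ∃ (p' : M → Metric.sphere (0 : EuclideanSpace ℝ (Fin 5)) 1) (k' : ℕ) (D' : Fin k' → Set M),
      k' < k ∧ IsW M p' k' D' ∧ DepthLeTwo p' k' D' := by
  obtain ⟨i, hi⟩ := hle
  rcases isolated_or_leaf_of_looseEnd hi with hiso | ⟨j, hleaf⟩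
  · exact hIso M e p k D hW hd i hiso
  · exact hLeaf M e p k D hW hd i j hleaf

/-- **COMPOSITION.**  The three stubs imply the crux `DepthTwoRung` (concluded BY NAME): strong
induction on the wrinkle number `k` (as an induction on an upper bound `n`); base `k = 0` by
`nonempty_diffeomorph_of_isW_zero`; a loose end is reduced by `stub_isolatedCancel` /
`stub_leafCut` (`looseEnd_reduce`); otherwise the presentation is a core (`core_of_no_looseEnd`)
with `k ≥ 3` (`three_le_of_core`), and `stub_coreCut` either lowers `k` or produces a loose end
without raising `k`, which is then reduced. -/
theorem DepthTwoRung_of :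
    Registered.stub_isolatedCancel → Registered.stub_leafCut → Registered.stub_coreCut →
      DepthTwoRung := by
  intro hIso hLeaf hCore M _ _ _ _ _ e p₀ k₀ D₀ hW₀ hd₀
  -- all presentations of `M` with at most `n` wrinkles, by induction on `n`
  suffices H : ∀ (n k : ℕ), k ≤ n →
      ∀ (p : M → Metric.sphere (0 : EuclideanSpace ℝ (Fin 5)) 1) (D : Fin k → Set M),
        IsW M p k D → DepthLeTwo p k D →
          Nonempty (M ≃ₘ⟮𝓡 4, 𝓡 4⟯ Metric.sphere (0 : EuclideanSpace ℝ (Fin 5)) 1) from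
    H k₀ k₀ le_rfl p₀ D₀ hW₀ hd₀
  intro n
  induction n with
  | zero =>
    intro k hk p D hW hd
    obtain rfl : k = 0 := Nat.le_zero.mp hk
    exact nonempty_diffeomorph_of_isW_zero M p D hW
  | succ n ih =>
    intro k hk p D hW hd
    by_cases hk0 : k = 0
    · subst hk0
      exact nonempty_diffeomorph_of_isW_zero M p D hW
    by_cases hle : ∃ i : Fin k, LooseEnd p k D i
    · obtain ⟨p', k', D', hlt, hW', hd'⟩ := looseEnd_reduce hIso hLeaf M e p k D hW hd hle
      exact ih k' (by omega) p' D' hW' hd'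
    · have hcore : Core p k D := core_of_no_looseEnd hle
      obtain ⟨p', k', D', hW', hd', hk'⟩ :=
        hCore M e p k D hW hd (three_le_of_core (Nat.pos_of_ne_zero hk0) hcore) hcore
      rcases hk' with hlt | ⟨hle', hloose⟩
      · exact ih k' (by omega) p' D' hW' hd'
      · obtain ⟨p'', k'', D'', hlt, hW'', hd''⟩ :=
          looseEnd_reduce hIso hLeaf M e p' k' D' hW' hd' hloose
        exact ih k'' (by omega) p'' D'' hW'' hd''

/-- Wiring check: the registered stubs feed `DepthTwoRung_of` exactly as stated, so the skeleton is
`DepthTwoRung` closed modulo the three stubs (sorries enter only through them). -/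
example : DepthTwoRung := DepthTwoRung_of stub_isolatedCancel stub_leafCut stub_coreCut

/-- COROLLARY (coherence with the route's rank-2 crux; informational, not part of the
registration): the two LOCAL moves alone give `TwoWrinkleRung` — with `k ≤ 2` every wrinkle is a
loose end, so the necklace rung is never invoked.  Hence `DepthTwoRung` exceeds `TwoWrinkleRung`
exactly by `CoreCut`. -/
theorem twoWrinkleRung_of :
    Registered.stub_isolatedCancel → Registered.stub_leafCut → TwoWrinkleRung := by
  intro hIso hLeaf M _ _ _ _ _ e p₀ k₀ D₀ hW₀ hk₀
  -- with at most two wrinkles there are no three pairwise distinct indices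
  have no3 : ∀ (k : ℕ), k ≤ 2 → ∀ (i j l : Fin k), i ≠ j → j ≠ l → i ≠ l → False := by
    intro k hk i j l hij hjl hil
    have h1 := i.isLt; have h2 := j.isLt; have h3 := l.isLt
    simp only [ne_eq, Fin.ext_iff] at hij hjl hil
    omega
  suffices H : ∀ (n k : ℕ), k ≤ n → k ≤ 2 →
      ∀ (p : M → Metric.sphere (0 : EuclideanSpace ℝ (Fin 5)) 1) (D : Fin k → Set M),
        IsW M p k D → DepthLeTwo p k D →
          Nonempty (M ≃ₘ⟮𝓡 4, 𝓡 4⟯ Metric.sphere (0 : EuclideanSpace ℝ (Fin 5)) 1) from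
    H k₀ k₀ le_rfl hk₀ p₀ D₀ hW₀ fun _ i j l hij hjl hil => (no3 k₀ hk₀ i j l hij hjl hil).elim
  intro n
  induction n with
  | zero =>
    intro k hk _ p D hW _
    obtain rfl : k = 0 := Nat.le_zero.mp hk
    exact nonempty_diffeomorph_of_isW_zero M p D hW
  | succ n ih =>
    intro k hk hk2 p D hW hd
    by_cases hk0 : k = 0
    · subst hk0
      exact nonempty_diffeomorph_of_isW_zero M p D hW
    · have hpos : 0 < k := Nat.pos_of_ne_zero hk0
      have hle : ∃ i : Fin k, LooseEnd p k D i :=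
        ⟨⟨0, hpos⟩, fun j l hji hli hjl => (no3 k hk2 ⟨0, hpos⟩ j l (Ne.symm hji) hjl
          (fun h => hli h.symm)).elim⟩
      obtain ⟨p', k', D', hlt, hW', hd'⟩ := looseEnd_reduce hIso hLeaf M e p k D hW hd hle
      exact ih k' (by omega) (by omega) p' D' hW' hd'

end Summit.SmoothPoincare4.SmoothPoincare4.Cruxes.DepthTwoRung.Birth
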